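import Literature.Topology.FourManifolds.SimplifiedBrokenLefschetzFibrationProofs
import Literature.Topology.FourManifolds.SliceCharts
import Literature.Topology.FourManifolds.OneManifoldCircle
import Literature.Topology.FourManifolds.OneManifoldOrientableGeneral
import Literature.Topology.FourManifolds.SchoenfliesSphereTwoHolds
import Literature.Topology.FourManifolds.CerfGammaFourProofs
import HarnessLib

/-!
# The round image of a simplified broken Lefschetz fibration is a smoothly embedded circle;
# normalisation to the equator

Topic `Literature/Topology/FourManifolds`; groundwork for the Euler count
`card_eq_four_mul_of_sblf_of_homotopyEquiv_sphere_four` (Baykur 2012, Lemma 7) of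
`SimplifiedBrokenLefschetzFibration.lean`.  Everything here is **proved**; there are no
definitions and no named facts.

For an SBLF `f : X → S²` on a closed 4-manifold (`IsSimplifiedBrokenLefschetzFibration o f L h`)
with round locus `Z = {df not onto} ∖ L`:

* `IsSimplifiedBrokenLefschetzFibration.exists_sliceChart_image_round` — **the round image
  `C = f(Z)` is a codimension-one slice subset of `S²`**: every point of `C` lies in a chart of
  the maximal atlas of `S²` in which `C` is `{last coordinate = 0}` (the base chart `ψ` of an
  indefinite fold chart, Hayano 2011, Def. 2.1 (4), restricted so that far-away branches of `Z`
  stay out: `f` is injective on the critical set, Def. 2.1 (5), and `Z` is compact);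
* `IsSimplifiedBrokenLefschetzFibration.exists_sphereEmbedding_range_eq_image_round` — hence
  (Lee 2013, Thm. 5.8 as the tree's `SliceChartFamily`; every `1`-manifold is orientable,
  `OneManifold.isOrientable`; a compact connected oriented `1`-manifold is a circle,
  `nonempty_diffeomorph_sphere_one_of_smoothOrientation`) **`C` is the range of a smooth
  embedding `S¹ → S²`** (`SphereEmbedding 1 2`) — Baykur–Kamada 2015, §3: *"its image on `S²`
  to be embedded"*;
* `IsSimplifiedBrokenLefschetzFibration.exists_diffeomorph_image_round_eq_sphereEquator` — by
  the smooth Schoenflies theorem on `S²` (the tree's PROVED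
  `SphereEmbedding.exists_diffeomorph_image_eq_sphereEquator_one`) **some diffeomorphism of `S²`
  carries the round image onto the standard equator**;
* `IsSimplifiedBrokenLefschetzFibration.comp_diffeomorph` — **SBLF structures transport along
  diffeomorphisms of the base** (same Lefschetz set, same genera), and
  `IsSimplifiedBrokenLefschetzFibration.exists_image_round_eq_sphereEquator` — **every SBLF may
  be normalised so that its round image IS the equator** `{v | v₂ = 0}` of `S²`.

## References

* K. Hayano, *On genus-1 simplified broken Lefschetz fibrations*, Algebr. Geom. Topol. 11 (2011),
  Def. 2.1. [Hayano2011]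
* R. İ. Baykur, S. Kamada, *Classification of broken Lefschetz fibrations with small fiber
  genera*, J. Math. Soc. Japan 67 (2015), §3. [BaykurKamada2015]
* J. M. Lee, *Introduction to Smooth Manifolds*, 2nd ed. (2013), Thm. 5.8. [LeeSmoothManifolds2013]
-/

noncomputable section

open scoped Manifold ContDiff Topology
open Set Function

namespace Literature.Topology.FourManifolds

namespace IsSimplifiedBrokenLefschetzFibration

variable {X : Type*} [TopologicalSpace X] [ChartedSpace (EuclideanSpace ℝ (Fin 4)) X]
  [IsManifold (𝓡 4) ∞ X] {o : SmoothOrientation (𝓡 4) X}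
  {f : X → Metric.sphere (0 : EuclideanSpace ℝ (Fin 3)) 1} {L : Finset X} {h : ℕ}

/-! ### The round image is a slice subset of `S²` -/

/-- **Slice charts for the round image.**  Let `f` be an SBLF on a compact `X` and `c = f p` a
point of the round image, `p` a round point.  Then there is a chart `e` of the maximal `C^∞`
atlas of `S²` at `c` in which the round image is the slice `{y₁ = 0}`: `e` is the base chart
`ψ` of an indefinite fold chart `(φ, ψ)` at `p` (Hayano 2011, Def. 2.1 (4): `f = (t, x₁² + x₂² -
x₃²)`, round locus the `t`-axis, round image the curve `s = 0`), restricted to the open set of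
points `q` with `(ψ q)₀` in the `t`-range of `φ` and off the compact set `f (Z ∖ dom φ)` — which
misses `c` because `f` is injective on the critical set (Def. 2.1 (5)).
[cite: Hayano2011, Def. 2.1 (4)–(5)] -/
theorem exists_sliceChart_image_round [CompactSpace X]
    (hf : IsSimplifiedBrokenLefschetzFibration o f L h)
    {c : Metric.sphere (0 : EuclideanSpace ℝ (Fin 3)) 1}
    (hc : c ∈ f '' ({p : X | ¬ Surjective (mfderiv (𝓡 4) (𝓡 2) f p)} \ (↑L : Set X))) :
    ∃ e : OpenPartialHomeomorph (Metric.sphere (0 : EuclideanSpace ℝ (Fin 3)) 1)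
        (EuclideanSpace ℝ (Fin 2)),
      e ∈ IsManifold.maximalAtlas (𝓡 2) ∞ (Metric.sphere (0 : EuclideanSpace ℝ (Fin 3)) 1) ∧
      c ∈ e.source ∧
      ∀ q ∈ e.source,
        q ∈ f '' ({p : X | ¬ Surjective (mfderiv (𝓡 4) (𝓡 2) f p)} \ (↑L : Set X)) ↔
          (e q) 1 = 0 := by
  obtain ⟨p, ⟨hp, hpL⟩, rfl⟩ := hc
  have hpL' : p ∉ L := fun h' => hpL (Finset.mem_coe.2 h')
  obtain ⟨φ, ψ, hpφ, hφ0, hmaps, hφ, hφs, hψ, hψs, hmodel⟩ := hf.fold p hp hpL'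
  set Z : Set X := {p : X | ¬ Surjective (mfderiv (𝓡 4) (𝓡 2) f p)} \ (↑L : Set X) with hZ
  have hfd : ∀ q, MDifferentiableAt (𝓡 4) (𝓡 2) f q := fun q =>
    (hf.contMDiff q).mdifferentiableAt (by simp)
  -- in the chart domain the round points are the points of the axis
  have haxis : ∀ q ∈ φ.source, (¬ Surjective (mfderiv (𝓡 4) (𝓡 2) f q) ↔
      (φ q) 1 = 0 ∧ (φ q) 2 = 0 ∧ (φ q) 3 = 0) := fun q hq => by
    rw [surjective_mfderiv_iff_of_fold_chart hmaps (hφ.of_le (by simp)) (hφs.of_le (by simp))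
      (hψ.of_le (by simp)) (hψs.of_le (by simp)) hmodel hq (hfd q), not_not]
  have hnoL : ∀ q ∈ φ.source, q ∉ L := fun q hq hqL =>
    mfderiv_ne_zero_of_fold_chart hmaps (hφ.of_le (by simp)) (hφs.of_le (by simp))
      (hψ.of_le (by simp)) (hψs.of_le (by simp)) hmodel hq (hfd q)
      ((hf.lefschetz q hqL).mfderiv_eq_zero)
  -- the compact set `K = f (Z ∖ dom φ)` misses `f p`
  set K : Set (Metric.sphere (0 : EuclideanSpace ℝ (Fin 3)) 1) := f '' (Z \ φ.source) with hK
  have hKc : IsClosed K :=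
    ((hf.isClosed_round.sdiff φ.open_source).isCompact.image hf.contMDiff.continuous).isClosed
  have hpK : f p ∉ K := by
    rintro ⟨q, ⟨⟨hq, -⟩, hqφ⟩, hqp⟩
    exact hqφ (hf.injOn_crit hq hp hqp ▸ hpφ)
  -- the open set of points whose `t`-coordinate is in the `t`-range of `φ`
  set U₀ : Set (EuclideanSpace ℝ (Fin 2)) :=
    {y | (WithLp.toLp 2 ![y 0, 0, 0, 0] : EuclideanSpace ℝ (Fin 4)) ∈ φ.target} with hU₀
  have hU₀o : IsOpen U₀ := by
    have hcont : Continuous fun y : EuclideanSpace ℝ (Fin 2) =>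
        (WithLp.toLp 2 ![y 0, 0, 0, 0] : EuclideanSpace ℝ (Fin 4)) := by
      refine PiLp.continuous_toLp 2 _ |>.comp ?_
      refine continuous_pi fun i => ?_
      fin_cases i
      · exact (PiLp.continuous_apply 2 _ (0 : Fin 2))
      · exact continuous_const
      · exact continuous_const
      · exact continuous_const
    exact φ.open_target.preimage hcont
  set V : Set (Metric.sphere (0 : EuclideanSpace ℝ (Fin 3)) 1) := ψ ⁻¹' U₀ ∩ Kᶜ with hV
  have hVo' : IsOpen (ψ.source ∩ V) := by
    rw [hV, ← inter_assoc]
    exact (ψ.continuousOn.isOpen_inter_preimage ψ.open_source hU₀o).inter hKc.isOpen_compl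
  set e := ψ.restr (ψ.source ∩ V) with he_def
  have he_source : e.source = ψ.source ∩ V := by
    rw [he_def, ψ.restr_source' _ hVo', ← inter_assoc, inter_self]
  refine ⟨e, ?_, ?_, ?_⟩
  · -- a restriction of a chart with smooth inverse is in the maximal atlas
    refine OpenPartialHomeomorph.mem_maximalAtlas_of_contMDiffOn e ?_ ?_
    · rw [he_source]
      exact hψ.mono inter_subset_left
    · intro y hy
      have hy' : y ∈ ψ.target := by
        rw [he_def] at hy
        exact (ψ.restr_target _ ▸ hy).1
      exact (hψs y hy').mono (by rw [he_def, ψ.restr_target]; exact inter_subset_left)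
  · -- `f p ∈ e.source`
    rw [he_source]
    refine ⟨hmaps hpφ, ?_, hpK⟩
    show ψ (f p) ∈ U₀
    rw [hU₀, mem_setOf_eq]
    obtain ⟨h0, -⟩ := hmodel p hpφ
    rw [h0, hφ0]
    convert φ.map_source hpφ using 1
    rw [hφ0]
    ext i; fin_cases i <;> simp
  · intro q hq
    rw [he_source] at hq
    obtain ⟨hqψ, hqU, hqK⟩ := hq
    have heq : e q = ψ q := by rw [he_def, ψ.restr_apply]
    rw [heq]
    constructor
    · -- a round point with value `q` lies in `dom φ` (else `q ∈ K`), hence on the axis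
      rintro ⟨p', hp'Z, rfl⟩
      have hp'φ : p' ∈ φ.source := by
        by_contra hcon
        exact hqK ⟨p', ⟨hp'Z, hcon⟩, rfl⟩
      obtain ⟨-, h1⟩ := hmodel p' hp'φ
      obtain ⟨e1, e2, e3⟩ := (haxis p' hp'φ).1 hp'Z.1
      rw [h1, e1, e2, e3]
      norm_num
    · -- a point `ψ⁻¹ (t, 0)` with `(t, 0, 0, 0) ∈ φ.target` is the value of an axis point
      intro hq1
      set u : EuclideanSpace ℝ (Fin 4) := WithLp.toLp 2 ![(ψ q) 0, 0, 0, 0] with hu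
      have huφ : u ∈ φ.target := hqU
      set p' := φ.symm u with hp'
      have hp'φ : p' ∈ φ.source := φ.map_target huφ
      have hφp' : φ p' = u := φ.right_inv huφ
      have hax : (φ p') 1 = 0 ∧ (φ p') 2 = 0 ∧ (φ p') 3 = 0 := by
        rw [hφp', hu]; simp
      refine ⟨p', ⟨(haxis p' hp'φ).2 hax, fun h' => hnoL p' hp'φ (Finset.mem_coe.1 h')⟩, ?_⟩
      -- `ψ (f p') = (t, 0) = ψ q`
      apply ψ.injOn (hmaps hp'φ) hqψ
      obtain ⟨h0, h1⟩ := hmodel p' hp'φ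
      rw [hφp', hu] at h0 h1
      ext i
      fin_cases i
      · simpa using h0
      · simpa [hq1] using h1

/-! ### The round image is an embedded circle -/

/-- **The round image of an SBLF is the range of a smooth embedding `S¹ → S²`.**  The round
image `C = f(Z)` of an SBLF on a closed 4-manifold is a compact connected codimension-one slice
subset of `S²` (`exists_sliceChart_image_round`); with the induced `C^∞` structure (Lee 2013,
Thm. 5.8, the tree's `SliceChartFamily`) it is a compact connected Hausdorff `1`-manifold, hence
orientable (`OneManifold.isOrientable`) and diffeomorphic to the circle
(`nonempty_diffeomorph_sphere_one_of_smoothOrientation`, Milnor 1965, Appendix); composing with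
the inclusion gives a `SphereEmbedding 1 2` with range `C` (Baykur–Kamada 2015, §3: the round
image of a simplified BLF is an embedded circle). [cite: BaykurKamada2015, §3] -/
theorem exists_sphereEmbedding_range_eq_image_round [CompactSpace X]
    (hf : IsSimplifiedBrokenLefschetzFibration o f L h) :
    ∃ S : SphereEmbedding 1 2,
      range S = f '' ({p : X | ¬ Surjective (mfderiv (𝓡 4) (𝓡 2) f p)} \ (↑L : Set X)) := by
  set C : Set (Metric.sphere (0 : EuclideanSpace ℝ (Fin 3)) 1) :=
    f '' ({p : X | ¬ Surjective (mfderiv (𝓡 4) (𝓡 2) f p)} \ (↑L : Set X)) with hC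
  -- slice charts
  choose e he_atlas he_mem he_iff using fun c : ↥C => hf.exists_sliceChart_image_round c.2
  let Ψ : SliceChartFamily (𝓡 2) C :=
    { chart := e
      mem_maximalAtlas := he_atlas
      mem_source := he_mem
      mem_iff := fun c q hq => by
        rw [he_iff c q hq]
        rfl
      mem_interior := fun c q _ => by
        rw [ModelWithCorners.Boundaryless.range_eq_univ, interior_univ]
        exact mem_univ _ }
  letI : ChartedSpace (EuclideanSpace ℝ (Fin 1)) ↥C := Ψ.chartedSpace
  haveI : IsManifold (𝓡 1) ∞ ↥C := Ψ.isManifold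
  haveI : CompactSpace ↥C := isCompact_iff_compactSpace.1 hf.isCompact_image_round
  haveI : ConnectedSpace ↥C := isConnected_iff_connectedSpace.1 hf.isConnected_image_round
  -- `C` is an oriented compact connected `1`-manifold, hence a circle
  obtain ⟨oC⟩ := OneManifold.isOrientable (M := ↥C)
  obtain ⟨Φ⟩ := nonempty_diffeomorph_sphere_one_of_smoothOrientation oC
  have hemb : Manifold.IsSmoothEmbedding (𝓡 1) (𝓡 2) ∞ (Subtype.val : ↥C → _) :=
    Ψ.isSmoothEmbedding_subtype_val
  refine ⟨⟨Subtype.val ∘ Φ.symm, hemb.comp_diffeomorph Φ.symm⟩, ?_⟩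
  show range (Subtype.val ∘ Φ.symm) = C
  have hr : range (⇑Φ.symm) = univ :=
    Function.Surjective.range_eq fun c => ⟨Φ c, Φ.symm_apply_apply c⟩
  rw [range_comp, hr, image_univ, Subtype.range_coe]

/-- **Schoenflies normalisation of the round image**: for an SBLF on a closed 4-manifold some
diffeomorphism of `S²` carries the round image onto the standard equator (the smooth Schoenflies
theorem on `S²`, the tree's `SphereEmbedding.exists_diffeomorph_image_eq_sphereEquator_one`,
applied to `exists_sphereEmbedding_range_eq_image_round`). [cite: BaykurKamada2015, §3] -/
theorem exists_diffeomorph_image_round_eq_sphereEquator [CompactSpace X]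
    (hf : IsSimplifiedBrokenLefschetzFibration o f L h) :
    ∃ Ψ : (Metric.sphere (0 : EuclideanSpace ℝ (Fin 3)) 1) ≃ₘ⟮𝓡 2, 𝓡 2⟯
        (Metric.sphere (0 : EuclideanSpace ℝ (Fin 3)) 1),
      Ψ '' (f '' ({p : X | ¬ Surjective (mfderiv (𝓡 4) (𝓡 2) f p)} \ (↑L : Set X))) =
        sphereEquator 1 := by
  obtain ⟨S, hS⟩ := hf.exists_sphereEmbedding_range_eq_image_round
  obtain ⟨Ψ, hΨ⟩ := S.exists_diffeomorph_image_eq_sphereEquator_one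
  exact ⟨Ψ, hS ▸ hΨ⟩

/-! ### Transport of SBLF structures along diffeomorphisms of the base -/

section Transport

/-- Local notation: the round 2-sphere. -/
local notation "𝕊²" => (Metric.sphere (0 : EuclideanSpace ℝ (Fin 3)) 1)

/-- The differential of a diffeomorphism of `S²` is bijective at every point. [folklore] -/
theorem bijective_mfderiv_diffeomorph (Ψ : 𝕊² ≃ₘ⟮𝓡 2, 𝓡 2⟯ 𝕊²) (y : 𝕊²) :
    Bijective (mfderiv (𝓡 2) (𝓡 2) Ψ y) := by
  have hΨd : Ψ.toHomeomorph.toOpenPartialHomeomorph.MDifferentiable (𝓡 2) (𝓡 2) :=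
    ⟨(Ψ.contMDiff.mdifferentiable (by simp)).mdifferentiableOn,
      (Ψ.symm.contMDiff.mdifferentiable (by simp)).mdifferentiableOn⟩
  exact hΨd.mfderiv_bijective (x := y) (by simp)

omit [IsManifold (𝓡 4) ∞ X] in
/-- **Regular points are unchanged by a diffeomorphism of the base**: `d(Ψ ∘ f)_q` is onto iff
`df_q` is. [folklore] -/
theorem surjective_mfderiv_diffeomorph_comp_iff (Ψ : 𝕊² ≃ₘ⟮𝓡 2, 𝓡 2⟯ 𝕊²)
    {q : X} (hfq : MDifferentiableAt (𝓡 4) (𝓡 2) f q) :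
    Surjective (mfderiv (𝓡 4) (𝓡 2) (Ψ ∘ f) q) ↔ Surjective (mfderiv (𝓡 4) (𝓡 2) f q) := by
  have hΨq : MDifferentiableAt (𝓡 2) (𝓡 2) Ψ (f q) := Ψ.contMDiff.mdifferentiableAt (by simp)
  rw [mfderiv_comp q hΨq hfq]
  obtain ⟨hinj, hsurj⟩ := bijective_mfderiv_diffeomorph Ψ (f q)
  constructor
  · intro hc y
    obtain ⟨v, hv⟩ := hc (mfderiv (𝓡 2) (𝓡 2) Ψ (f q) y)
    exact ⟨v, hinj hv⟩
  · intro hfs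
    exact hsurj.comp hfs

omit [IsManifold (𝓡 4) ∞ X] in
/-- The critical set of `Ψ ∘ f` is the critical set of `f`. [folklore] -/
theorem setOf_not_surjective_diffeomorph_comp (Ψ : 𝕊² ≃ₘ⟮𝓡 2, 𝓡 2⟯ 𝕊²)
    (hfd : ∀ q, MDifferentiableAt (𝓡 4) (𝓡 2) f q) :
    {p : X | ¬ Surjective (mfderiv (𝓡 4) (𝓡 2) (Ψ ∘ f) p)} =
      {p : X | ¬ Surjective (mfderiv (𝓡 4) (𝓡 2) f p)} := by
  ext q
  simp only [mem_setOf_eq, surjective_mfderiv_diffeomorph_comp_iff Ψ (hfd q)]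

omit [TopologicalSpace X] [ChartedSpace (EuclideanSpace ℝ (Fin 4)) X] [IsManifold (𝓡 4) ∞ X] in
/-- Fibres of `Ψ ∘ f` are fibres of `f`: `(Ψ ∘ f)⁻¹(y) = f⁻¹(Ψ⁻¹ y)`. [folklore] -/
theorem preimage_diffeomorph_comp_singleton (Ψ : 𝕊² ≃ₘ⟮𝓡 2, 𝓡 2⟯ 𝕊²) (y : 𝕊²) :
    (Ψ ∘ f) ⁻¹' {y} = f ⁻¹' {Ψ.symm y} := by
  ext q
  simp only [mem_preimage, Function.comp_apply, mem_singleton_iff]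
  constructor
  · intro hq; rw [← hq, Ψ.symm_apply_apply]
  · intro hq; rw [hq, Ψ.apply_symm_apply]

omit [IsManifold (𝓡 4) ∞ X] in
/-- Regular values of `Ψ ∘ f` correspond to regular values of `f` under `Ψ`. [folklore] -/
theorem forall_surjective_diffeomorph_comp_iff (Ψ : 𝕊² ≃ₘ⟮𝓡 2, 𝓡 2⟯ 𝕊²)
    (hfd : ∀ q, MDifferentiableAt (𝓡 4) (𝓡 2) f q) (y : 𝕊²) :
    (∀ q, (Ψ ∘ f) q = y → Surjective (mfderiv (𝓡 4) (𝓡 2) (Ψ ∘ f) q)) ↔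
      ∀ q, f q = Ψ.symm y → Surjective (mfderiv (𝓡 4) (𝓡 2) f q) := by
  constructor
  · intro H q hq
    rw [← surjective_mfderiv_diffeomorph_comp_iff Ψ (hfd q)]
    exact H q (by simp [hq])
  · intro H q hq
    rw [surjective_mfderiv_diffeomorph_comp_iff Ψ (hfd q)]
    exact H q (by rw [← hq, Function.comp_apply, Ψ.symm_apply_apply])

omit [IsManifold (𝓡 4) ∞ X] in
/-- A Lefschetz chart of `f` at `p` gives one of `Ψ ∘ f` at `p` with the same total-space chart
(base chart `ψ ∘ Ψ⁻¹`). [cite: GompfStipsiczGSM1999, Def. 8.1.4] -/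
theorem exists_lefschetzChart_diffeomorph_comp (Ψ : 𝕊² ≃ₘ⟮𝓡 2, 𝓡 2⟯ 𝕊²) {p : X}
    (c : LefschetzChart (𝓡 4) (𝓡 2) f p) :
    ∃ c' : LefschetzChart (𝓡 4) (𝓡 2) (Ψ ∘ f) p, c'.φ = c.φ := by
  refine ⟨{ φ := c.φ
            ψ := Ψ.symm.toHomeomorph.toOpenPartialHomeomorph.trans c.ψ
            mem_source := c.mem_source
            apply_eq_zero := c.apply_eq_zero
            mapsTo := fun q hq => ?_
            contMDiffOn := c.contMDiffOn
            contMDiffOn_symm := c.contMDiffOn_symm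
            contMDiffOn_base := ?_
            contMDiffOn_base_symm := ?_
            node_eq := fun q hq => ?_ }, rfl⟩
  · simp only [OpenPartialHomeomorph.trans_source, Homeomorph.toOpenPartialHomeomorph_source,
      univ_inter, mem_preimage]
    show Ψ.symm (Ψ (f q)) ∈ c.ψ.source
    rw [Ψ.symm_apply_apply]
    exact c.mapsTo hq
  · intro y hy
    simp only [OpenPartialHomeomorph.trans_source, Homeomorph.toOpenPartialHomeomorph_source,
      univ_inter, mem_preimage] at hy
    have h1 : ContMDiffAt (𝓡 2) 𝓘(ℝ, ℂ) ∞ (c.ψ ∘ Ψ.symm) y :=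
      ((c.contMDiffOn_base _ hy).contMDiffAt (c.ψ.open_source.mem_nhds hy)).comp y
        (Ψ.symm.contMDiff y)
    exact h1.contMDiffWithinAt
  · intro z hz
    simp only [OpenPartialHomeomorph.trans_target, mem_inter_iff, mem_preimage] at hz
    have h1 : ContMDiffAt 𝓘(ℝ, ℂ) (𝓡 2) ∞ (Ψ ∘ c.ψ.symm) z :=
      (Ψ.contMDiff _).comp z ((c.contMDiffOn_base_symm _ hz.1).contMDiffAt
        (c.ψ.open_target.mem_nhds hz.1))
    exact h1.contMDiffWithinAt
  · simp only [OpenPartialHomeomorph.coe_trans, Function.comp_apply]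
    show c.ψ (Ψ.symm (Ψ (f q))) = lefschetzNodeMap (c.φ q)
    rw [Ψ.symm_apply_apply]
    exact c.node_eq q hq

/-- **SBLF structures transport along diffeomorphisms of the base.**  If `f : X → S²` is a
simplified broken Lefschetz fibration (Lefschetz set `L`, lower genus `h`) and `Ψ` a
diffeomorphism of `S²`, then so is `Ψ ∘ f`, with the same Lefschetz set and genera: Lefschetz
and fold charts keep their total-space chart and take the base chart `ψ ∘ Ψ⁻¹`, the critical set
and the regular values are unchanged up to `Ψ`, and the fibres of `Ψ ∘ f` are fibres of `f`.
[cite: BaykurKamada2015, §3] -/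
theorem comp_diffeomorph (hf : IsSimplifiedBrokenLefschetzFibration o f L h)
    (Ψ : 𝕊² ≃ₘ⟮𝓡 2, 𝓡 2⟯ 𝕊²) : IsSimplifiedBrokenLefschetzFibration o (Ψ ∘ f) L h := by
  have hfd : ∀ q, MDifferentiableAt (𝓡 4) (𝓡 2) f q := fun q =>
    (hf.contMDiff q).mdifferentiableAt (by simp)
  have hcrit := setOf_not_surjective_diffeomorph_comp Ψ hfd
  refine
    { contMDiff := Ψ.contMDiff.comp hf.contMDiff
      surjective := Ψ.surjective.comp hf.surjective
      lefschetz := fun p hp => ?_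
      fold := fun p hp hpL => ?_
      isConnected_round := by rw [hcrit]; exact hf.isConnected_round
      injOn_crit := by rw [hcrit]; exact Ψ.injective.comp_injOn hf.injOn_crit
      fibre := fun y hy => ?_
      exists_higher := ?_
      exists_lower := ?_
      lefschetz_higher := fun p hp => ?_ }
  · -- Lefschetz charts
    obtain ⟨c, hc⟩ := hf.lefschetz p hp
    obtain ⟨c', hc'⟩ := exists_lefschetzChart_diffeomorph_comp Ψ c
    refine ⟨c', ?_⟩
    have : c'.IsPositive o ↔ c.IsPositive o := by
      rw [LefschetzChart.isPositive_iff, LefschetzChart.isPositive_iff, hc']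
    rw [this]
    exact hc
  · -- fold charts
    have hp' : ¬ Surjective (mfderiv (𝓡 4) (𝓡 2) f p) := by
      rwa [surjective_mfderiv_diffeomorph_comp_iff Ψ (hfd p)] at hp
    obtain ⟨φ, ψ, hpφ, hφ0, hmaps, hφ, hφs, hψ, hψs, hmodel⟩ := hf.fold p hp' hpL
    refine ⟨φ, Ψ.symm.toHomeomorph.toOpenPartialHomeomorph.trans ψ, hpφ, hφ0, ?_, hφ, hφs,
      ?_, ?_, ?_⟩
    · intro q hq
      simp only [OpenPartialHomeomorph.trans_source, Homeomorph.toOpenPartialHomeomorph_source,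
        univ_inter, mem_preimage]
      show Ψ.symm (Ψ (f q)) ∈ ψ.source
      rw [Ψ.symm_apply_apply]
      exact hmaps hq
    · intro y hy
      simp only [OpenPartialHomeomorph.trans_source, Homeomorph.toOpenPartialHomeomorph_source,
        univ_inter, mem_preimage] at hy
      have h1 : ContMDiffAt (𝓡 2) (𝓡 2) ∞ (ψ ∘ Ψ.symm) y :=
        ((hψ _ hy).contMDiffAt (ψ.open_source.mem_nhds hy)).comp y (Ψ.symm.contMDiff y)
      exact h1.contMDiffWithinAt
    · intro z hz
      simp only [OpenPartialHomeomorph.trans_target, mem_inter_iff, mem_preimage] at hz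
      have h1 : ContMDiffAt (𝓡 2) (𝓡 2) ∞ (Ψ ∘ ψ.symm) z :=
        (Ψ.contMDiff _).comp z ((hψs _ hz.1).contMDiffAt (ψ.open_target.mem_nhds hz.1))
      exact h1.contMDiffWithinAt
    · intro q hq
      simp only [OpenPartialHomeomorph.coe_trans, Function.comp_apply]
      have e1 : Ψ.symm.toHomeomorph.toOpenPartialHomeomorph (Ψ (f q)) = f q :=
        Ψ.symm_apply_apply (f q)
      rw [e1]
      exact hmodel q hq
  · -- fibres
    rw [forall_surjective_diffeomorph_comp_iff Ψ hfd] at hy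
    rw [preimage_diffeomorph_comp_singleton]
    exact hf.fibre (Ψ.symm y) hy
  · obtain ⟨y, hy, hclause⟩ := hf.exists_higher
    refine ⟨Ψ y, ?_, ?_⟩
    · rw [forall_surjective_diffeomorph_comp_iff Ψ hfd, Ψ.symm_apply_apply]; exact hy
    · rw [preimage_diffeomorph_comp_singleton, Ψ.symm_apply_apply]; exact hclause
  · obtain ⟨y, hy, hclause⟩ := hf.exists_lower
    refine ⟨Ψ y, ?_, ?_⟩
    · rw [forall_surjective_diffeomorph_comp_iff Ψ hfd, Ψ.symm_apply_apply]; exact hy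
    · rw [preimage_diffeomorph_comp_singleton, Ψ.symm_apply_apply]; exact hclause
  · -- Lefschetz points on the higher side: push the neighbourhood filter forward along `Ψ`
    have key := hf.lefschetz_higher p hp
    have hmap : 𝓝 ((Ψ ∘ f) p) = Filter.map Ψ (𝓝 (f p)) :=
      (Ψ.toHomeomorph.map_nhds_eq (f p)).symm
    rw [hmap, Filter.eventually_map]
    filter_upwards [key] with x hx hreg
    rw [forall_surjective_diffeomorph_comp_iff Ψ hfd, Ψ.symm_apply_apply] at hreg
    rw [preimage_diffeomorph_comp_singleton, Ψ.symm_apply_apply]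
    exact hx hreg

/-- **Normalisation of the round image.**  Every SBLF on a closed 4-manifold can be composed
with a diffeomorphism of `S²` so as to become an SBLF — same orientation, Lefschetz set and
genera — whose round image is exactly the standard equator `sphereEquator 1 = {v | v₂ = 0}`
(`exists_diffeomorph_image_round_eq_sphereEquator` with `comp_diffeomorph`).
[cite: BaykurKamada2015, §3] -/
theorem exists_image_round_eq_sphereEquator [CompactSpace X]
    (hf : IsSimplifiedBrokenLefschetzFibration o f L h) :
    ∃ f' : X → 𝕊², IsSimplifiedBrokenLefschetzFibration o f' L h ∧
      f' '' ({p : X | ¬ Surjective (mfderiv (𝓡 4) (𝓡 2) f' p)} \ (↑L : Set X)) =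
        sphereEquator 1 := by
  obtain ⟨Ψ, hΨ⟩ := hf.exists_diffeomorph_image_round_eq_sphereEquator
  have hfd : ∀ q, MDifferentiableAt (𝓡 4) (𝓡 2) f q := fun q =>
    (hf.contMDiff q).mdifferentiableAt (by simp)
  refine ⟨Ψ ∘ f, hf.comp_diffeomorph Ψ, ?_⟩
  rw [setOf_not_surjective_diffeomorph_comp Ψ hfd, image_comp]
  exact hΨ

end Transport

end IsSimplifiedBrokenLefschetzFibration

end Literature.Topology.FourManifolds
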